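import Summits.CriticalPhenomena.PercolationContinuityZ3.Theorems.PercNearOneGluingNoHeavyQuantHeavySingleMixture
import HarnessLib

/-!
# QUANT lane R8, T-DEC: THE NECESSARY CONDITION OF THE MOMENT ROUTE — every common-target mixture certificate of the heavy-single U-part
# (any width; products or any positively associated arrangement of the sibling blocks) forces `(1 − q₁)·m* ≤ (1 − qᵢ)·mᵢ` for every sibling
# (arm-1 gen 53, architect)

builds on p205010 (kernel theorem, internal audit signed; external expert review pending)

Support file (`--supports stmt-CriticalPhenomena-4575`), QUANT lane seat prim-quant-arm-1 (gen 53, architect); memo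
`run/shared/lean/prim/quant/prim-quant-arm-1-g53/ARCH-G53.md` §2.  Theorems only (pure real algebra over finite sums), standard axioms, no sorries.
Companion of ✓ `…QuantHeavySingleMixture` (`sdec_flaw_heavySingle_of_patterns`: ANY admissible mixture of re-gated sub-forests presenting the opened
compound closes the heavy-single sibling step) and ✓ `…QuantHeavySingleStep` (the balanced U-RPM solution).

THE BOUND (`moment_necessary`).  Index the light siblings by `i ∈ R` (opened means `mᵢ ≥ 0`), the components by a finite type (weights `λ_c ≥ 0`,
`Σ λ = 1`, root-open probabilities `o^c_i ∈ [0,1]`).  IF every genuine component sits on the mean hyperplane `Σ_i mᵢ·o^c_i = m*` (forced for a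
common-target DEC mixture: each component mean is `≥ m*` and their average is `m*`), the marginals are `Σ_c λ_c o^c_i = lᵢ` (`lᵢ = qᵢ/q₁`, the root
marginals of the opened compound) and the pair moments are AT MOST the compound's, `Σ_c λ_c o^c_i o^c_j ≤ q₁·lᵢ·lⱼ` (`i ≠ j`; equality for product
components, `≤` for any positively associated arrangement — chains, relays — by Harris–FKG, since the compound's targets are what the mixture must hit
with `P_c(χᵢχⱼ) ≥ o^c_i o^c_j`), THEN for every `i ∈ R` with `lᵢ > 0`: **`(1 − q₁)·m* ≤ mᵢ·(1 − q₁ lᵢ) = (1 − qᵢ)·mᵢ`**.  Proof: multiply the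
marginal identity by the hyperplane, split `j = i` (`o² ≤ o`) from `j ≠ i` (pair moments), and use `m* = Σ_j lⱼ mⱼ` (`mstar_eq`).  So beyond this
inequality NO such certificate exists (ARCH-G53 §2; census kit j268544: the inequality admits 96 / 90 / 92 % of random heavy-orientation groups of
width 3 / 4 / 5, the balanced theorem 43 / 6 / 1.5 %, product mixtures at the true floor 64 / 52 / 44 %).
* `mstar_eq` (the hyperplane and the marginals give `m* = Σ lⱼ mⱼ`), **`moment_necessary`**.

HONEST STATUS: a no-go boundary for ONE certificate scheme (common-target oracle mixtures in the heavy-single orientation), not a statement about the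
node; `SiblingStep`, `GateStepN`, `LightResidDECOracle`, `FarTreeRow` OPEN; RATE class (log\*) / honest sentence of `run/shared/lean/prim/quant/README.md`
unchanged.  [this work].  Nothing here is cited as a published result.  The gluing rows served [cite: KozmaNitzan2024, Conjecture 3 (p. 15)]; product
measure [cite: Grimmett1999, §1.3 p. 10].
-/

noncomputable section

open scoped BigOperators

namespace Summit.CriticalPhenomena.PercolationContinuityZ3.Theorems
namespace Quant
namespace URPM

open Finset

/-- **the hyperplane and the marginals determine `m*`**: if every genuine component has `Σ_i mᵢ o^c_i = m*` and `Σ_c λ_c o^c_i = lᵢ`, `Σ λ = 1`, then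
`m* = Σ_i lᵢ mᵢ`. [this work] -/
theorem mstar_eq {ι C : Type*} [Fintype C] (R : Finset ι) (lam : C → ℝ) (o : C → ι → ℝ) (m l : ι → ℝ) (mstar : ℝ)
    (hlam1 : ∑ c, lam c = 1) (hyper : ∀ c, 0 < lam c → ∑ j ∈ R, m j * o c j = mstar) (hlam0 : ∀ c, 0 ≤ lam c)
    (hmarg : ∀ i ∈ R, ∑ c, lam c * o c i = l i) : mstar = ∑ j ∈ R, l j * m j := by
  have h1 : ∑ c, lam c * ∑ j ∈ R, m j * o c j = mstar := by
    have e : ∀ c ∈ (Finset.univ : Finset C), lam c * ∑ j ∈ R, m j * o c j = lam c * mstar := by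
      intro c _
      rcases eq_or_lt_of_le (hlam0 c) with h0 | hpos
      · rw [← h0, zero_mul, zero_mul]
      · rw [hyper c hpos]
    rw [Finset.sum_congr rfl e, ← Finset.sum_mul, hlam1, one_mul]
  have h2 : ∑ c, lam c * ∑ j ∈ R, m j * o c j = ∑ j ∈ R, l j * m j := by
    simp_rw [Finset.mul_sum]
    rw [Finset.sum_comm]
    refine Finset.sum_congr rfl fun j hj => ?_
    rw [← hmarg j hj, Finset.sum_mul]
    exact Finset.sum_congr rfl fun c _ => by ring
  rw [← h1, h2]

/-- **THE NECESSARY CONDITION OF THE MOMENT ROUTE** (see the module docstring): hyperplane + marginals `lᵢ` + pair moments `≤ q₁ lᵢ lⱼ` + `o ∈ [0,1]`,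
`m ≥ 0` ⟹ `(1 − q₁)·m* ≤ mᵢ·(1 − q₁·lᵢ)` for every `i ∈ R` with `lᵢ > 0`. [this work] -/
theorem moment_necessary {ι C : Type*} [Fintype C] [DecidableEq ι] (R : Finset ι) (lam : C → ℝ) (o : C → ι → ℝ) (m l : ι → ℝ)
    (q₁ mstar : ℝ) (hlam0 : ∀ c, 0 ≤ lam c) (hlam1 : ∑ c, lam c = 1)
    (ho0 : ∀ c i, 0 ≤ o c i) (ho1 : ∀ c i, o c i ≤ 1) (hm : ∀ j ∈ R, 0 ≤ m j)
    (hyper : ∀ c, 0 < lam c → ∑ j ∈ R, m j * o c j = mstar) (hmarg : ∀ i ∈ R, ∑ c, lam c * o c i = l i)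
    (hpair : ∀ i ∈ R, ∀ j ∈ R, i ≠ j → ∑ c, lam c * (o c i * o c j) ≤ q₁ * l i * l j)
    {i : ι} (hi : i ∈ R) (hli : 0 < l i) : (1 - q₁) * mstar ≤ m i * (1 - q₁ * l i) := by
  have hms : mstar = ∑ j ∈ R, l j * m j := mstar_eq R lam o m l mstar hlam1 hyper hlam0 hmarg
  -- `m*·lᵢ = Σ_j m_j · Σ_c λ_c o_i o_j`
  have key : mstar * l i = ∑ j ∈ R, m j * ∑ c, lam c * (o c i * o c j) := by
    have e1 : mstar * l i = ∑ c, lam c * o c i * ∑ j ∈ R, m j * o c j := by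
      rw [← hmarg i hi, Finset.mul_sum]
      refine Finset.sum_congr rfl fun c _ => ?_
      rcases eq_or_lt_of_le (hlam0 c) with h0 | hpos
      · rw [← h0]; ring
      · rw [hyper c hpos]; ring
    rw [e1]
    simp_rw [Finset.mul_sum]
    rw [Finset.sum_comm]
    refine Finset.sum_congr rfl fun j _ => ?_
    exact Finset.sum_congr rfl fun c _ => by ring
  -- split `j = i` from `j ≠ i`
  rw [← Finset.add_sum_erase R _ hi] at key
  have hdiag : ∑ c, lam c * (o c i * o c i) ≤ l i := by
    rw [← hmarg i hi]
    refine Finset.sum_le_sum fun c _ => ?_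
    have : o c i * o c i ≤ o c i := by nlinarith [ho0 c i, ho1 c i]
    exact mul_le_mul_of_nonneg_left this (hlam0 c)
  have hoff : ∑ j ∈ R.erase i, m j * ∑ c, lam c * (o c i * o c j) ≤ ∑ j ∈ R.erase i, m j * (q₁ * l i * l j) := by
    refine Finset.sum_le_sum fun j hj => ?_
    have hjR : j ∈ R := Finset.mem_of_mem_erase hj
    exact mul_le_mul_of_nonneg_left (hpair i hi j hjR (Finset.ne_of_mem_erase hj).symm) (hm j hjR)
  have hsum : ∑ j ∈ R.erase i, m j * (q₁ * l i * l j) = q₁ * l i * (mstar - l i * m i) := by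
    have e : ∑ j ∈ R.erase i, m j * (q₁ * l i * l j) = q₁ * l i * ∑ j ∈ R.erase i, l j * m j := by
      rw [Finset.mul_sum]; exact Finset.sum_congr rfl fun j _ => by ring
    rw [e, hms, ← Finset.add_sum_erase R _ hi]
    ring
  have hmi : 0 ≤ m i := hm i hi
  have h1 : mstar * l i ≤ m i * l i + q₁ * l i * (mstar - l i * m i) := by
    calc mstar * l i = m i * ∑ c, lam c * (o c i * o c i) + ∑ j ∈ R.erase i, m j * ∑ c, lam c * (o c i * o c j) := key
      _ ≤ m i * l i + ∑ j ∈ R.erase i, m j * (q₁ * l i * l j) := add_le_add (mul_le_mul_of_nonneg_left hdiag hmi) hoff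
      _ = m i * l i + q₁ * l i * (mstar - l i * m i) := by rw [hsum]
  -- divide by `lᵢ > 0`
  have h2 : l i * ((1 - q₁) * mstar - m i * (1 - q₁ * l i)) ≤ 0 := by nlinarith
  nlinarith

end URPM
end Quant
end Summit.CriticalPhenomena.PercolationContinuityZ3.Theorems
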